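import Mathlib
import Literature.NumberTheory.EllipticCurves.IwasawaAlgebra
import Literature.NumberTheory.GaloisRepresentations.EulerSystem
import Literature.NumberTheory.GaloisRepresentations.BlochKatoSelmerGroup

/-!
# Sketch — first lemmas for crux ideas on `VerticalSelmerBound` (stmt-BirchSwinnertonDyer-18432)

Ideator planner-cruxidea-stmt-BirchSwinnertonDyer-18432-2-0, round 1.

* Idea `crossing-point-total-order`: Lemma A (`rank_le_totalOrder_of_mem_charIdeal`) and the
  evaluation lemma (`val_eval_ge_of_mem_pow`), over the two-variable Iwasawa algebra
  `Λ₂ = ℤ_p⟦T⟧⟦S⟧ = PowerSeries (IwasawaAlgebra p)` (`S` = weight variable `κ - κ₂`,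
  `T` = anticyclotomic variable `γ - 1`), with the tree's generic `Module.charIdeal`.
* Idea `beilinson-flach-engine`: the rank-zero Euler-system bound over a base number field `K`
  (Rubin, *Euler Systems*, Thm. 2.2.2 + §2.3 shape) as an interface `Prop` over the tree's
  `IsEulerSystem` / `HasBottomValue` / `SelmerStructure.HasCardLE`.
-/

noncomputable section

open scoped BigOperators

namespace Summit.BirchSwinnertonDyer.BirchSwinnertonDyer.Cruxes.VerticalSelmerBound.Sketch

open Literature.NumberTheory.EllipticCurves

variable (p : ℕ) [Fact p.Prime]

/-- The two-variable Iwasawa algebra `Λ₂ = ℤ_p⟦T⟧⟦S⟧` (outer variable `S` = weight,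
inner variable `T` = anticyclotomic). -/
abbrev Lambda2 : Type := PowerSeries (IwasawaAlgebra p)

/-- The total order of `g ∈ Λ₂` at the crossing point `𝔭₀ = (S, T)`:
`ord_{𝔭₀}(g) = min { i + ord_T(g_i) }` where `g = ∑ g_i(T) S^i`, i.e. the largest `n` with
`g ∈ (S, T)^n` (value `⊤` for `g = 0`). -/
def totalOrder (g : Lambda2 p) : ℕ∞ :=
  ⨅ i : ℕ, (PowerSeries.order (PowerSeries.coeff i g) + i)

/-- The ideal `𝔭₀ = (S, T) ⊂ Λ₂` of the crossing point (weight 2, trivial character): a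
height-two prime with `Λ₂ / 𝔭₀ = ℤ_p`. -/
def crossingIdeal : Ideal (Lambda2 p) :=
  Ideal.span {PowerSeries.X, PowerSeries.C (PowerSeries.X : IwasawaAlgebra p)}

/-- `rank_{ℤ_p} (M / 𝔭₀ M)`, measured as `dim_{ℚ_p} ℚ_p ⊗_{ℤ_p} (M / 𝔭₀ M)` (junk value `0` when
infinite-dimensional), in the style of the tree's `coinvariantsRank`. -/
def crossingRank (M : Type) [AddCommGroup M] [Module (Lambda2 p) M] : ℕ :=
  Module.finrank ℚ_[p]
    (TensorProduct ℤ_[p] ℚ_[p]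
      (RestrictScalars ℤ_[p] (Lambda2 p) (M ⧸ (crossingIdeal p • (⊤ : Submodule (Lambda2 p) M)))))

/-- **Lemma A (codimension-two presentation lemma; first lemma of idea
`crossing-point-total-order`).** Let `M` be a finitely generated torsion `Λ₂`-module whose
`𝔭₀`-torsion is `p`-power torsion (equivalently `𝔭₀ ∉ Ass(M)`: `M` has no nonzero submodule
supported at the crossing point — Greenberg's "no pseudo-null submodule" gives this). Then for
every `g` in the characteristic ideal of `M`,
`rank_{ℤ_p}(M / 𝔭₀ M) ≤ ord_{𝔭₀}(g)`.
Proof in words: `R = (Λ₂)_{𝔭₀}` is regular local of dimension `2` with maximal ideal `(S, T)`;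
`depth M_{𝔭₀} ≥ 1` so `pd M_{𝔭₀} ≤ 1` (Auslander–Buchsbaum) and `M_{𝔭₀}` torsion forces a square
minimal presentation `0 → Rⁿ →ᴬ Rⁿ → M_{𝔭₀} → 0` with `n = μ(M_{𝔭₀}) ≥ rank_{ℤ_p}(M/𝔭₀M)` and all
entries of `A` in `𝔭₀ R`; hence `char(M) R = Fitt₀ = (det A) ⊆ 𝔭₀ⁿ R`, and `𝔭₀` is generated by
a regular sequence so `𝔭₀ⁿ R ∩ Λ₂ = 𝔭₀ⁿ`. (Two-variable analogue of the tree's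
`IwasawaAlgebra.coinvariantsRank_le_order_of_mem_charIdeal`.) -/
theorem rank_le_totalOrder_of_mem_charIdeal (M : Type) [AddCommGroup M] [Module (Lambda2 p) M]
    [Module.Finite (Lambda2 p) M] (hM : Module.IsTorsion (Lambda2 p) M)
    (hdepth : ∀ m : M, (PowerSeries.X : Lambda2 p) • m = 0 →
      (PowerSeries.C (PowerSeries.X : IwasawaAlgebra p) : Lambda2 p) • m = 0 →
        ∃ n : ℕ, (p ^ n : Lambda2 p) • m = 0)
    (g : Lambda2 p) (hg : g ∈ Module.charIdeal (Lambda2 p) M) :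
    (crossingRank p M : ℕ∞) ≤ totalOrder p g := by
  sorry

/-- **Evaluation lemma (T3 of idea `crossing-point-total-order`).** If `g ∈ 𝔭₀^s` then at any
`ℤ_p`-point `(S, T) ↦ (a, b)` with `p^e ∣ a` and `p^e ∣ b` (depth-`N` arithmetic weights on the
branch and the canonical character `ν̂_k ≡ 1 mod p^{N+1}` give `e = N + 1`), the value of `g` is
divisible by `p^{s e}` — with NO Weierstrass preparation and no uniformity input. Evaluation of
`g = ∑ g_{ij} S^i T^j` at `(a, b)` with `a, b ∈ pℤ_p` is the convergent sum `∑ g_{ij} aⁱ bʲ`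
(written with `PowerSeries.evalAt`-free elementary data: we only state the divisibility of every
TRUNCATED double sum, which is what the finite-level crux consumes). -/
theorem val_eval_ge_of_mem_pow (s e : ℕ) (g : Lambda2 p) (hg : g ∈ crossingIdeal p ^ s)
    (a b : ℤ_[p]) (ha : (p : ℤ_[p]) ^ e ∣ a) (hb : (p : ℤ_[p]) ^ e ∣ b) (B : ℕ) :
    (p : ℤ_[p]) ^ (s * e) ∣
      ∑ i ∈ Finset.range B, ∑ j ∈ Finset.range B,
        PowerSeries.coeff j (PowerSeries.coeff i g) * a ^ i * b ^ j := by
  sorry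

end Summit.BirchSwinnertonDyer.BirchSwinnertonDyer.Cruxes.VerticalSelmerBound.Sketch

/-! ### Idea `beilinson-flach-engine`: the rank-zero Euler-system bound over a base field `K` -/

namespace Summit.BirchSwinnertonDyer.BirchSwinnertonDyer.Cruxes.VerticalSelmerBound.Sketch

open Literature.NumberTheory.GaloisRepresentations IsDedekindDomain NumberField CategoryTheory

universe u

/-- **Rank-zero Euler-system bound over a number field `K`, finite level (Rubin 2000,
Thm. 2.2.2 shape; first lemma of idea `beilinson-flach-engine`).** Let `Tₙ` be a free
`ℤ/pⁿ`-representation of `Γ_K` (intended: `T_{f_k} ⊗ ν̂_k⁻¹ mod ϖ^{M}` for a weight-`k` member of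
the Hida branch, restricted to `G_K`), `L` Euler-system levels over `K` (ring-class / ray-class
tower of `K`: the Beilinson–Flach system of LLZ2015 §§3–5, built from KLZ2017 §8 classes for
arbitrary weight, is such an `L`-system), `c` an Euler system for `Tₙ` with bottom class `c_K`,
and `𝓛` a Selmer structure on the Tate dual `Tₙ^∨(1)` that is STRICT at the places above `p`
and unramified at the usable primes. If `Γ_K` has no invariants on `Tₙ/p` (residual, hence
uniform along the branch), then `#H¹_𝓛(K, Tₙ^∨(1)) ≤ [H¹(K, Tₙ) : ℤ/pⁿ · c_K] · p^C` with `C`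
depending only on the RESIDUAL representation (Rubin's `n_W + n_W^*`). The reciprocity law
(KLZ2017 Thm. B) then turns the index into `v_p(L_p(f_k/K)(ν̂_k)) + O(1)` — second stub.
Unproved interface fact, typed over the tree's `IsEulerSystem` / `tateDual` / `HasCardLE`. -/
def EulerSystemRankZeroBound : Prop :=
  ∀ (K : Type u) [Field K] [NumberField K] (p n : ℕ) [Fact p.Prime]
    (M : Type u) [AddCommGroup M] [Module (ZMod (p ^ n)) M] [TopologicalSpace M]
    [DiscreteTopology M] [IsTopologicalAddGroup M] [ContinuousSMul (ZMod (p ^ n)) M]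
    [Module.Free (ZMod (p ^ n)) M] [Module.Finite (ZMod (p ^ n)) M] [Finite M]
    [Algebra ℤ_[p] (ZMod (p ^ n))]
    (T : GaloisRep K (ZMod (p ^ n)) M) (L : EulerSystemLevels K ℕ)
    (c : ∀ (i : ℕ) (r : L.Ideals), H1 T (L.level i r.1)) (hc : IsEulerSystem L T p c)
    (𝓛 : DiscreteGaloisModule.SelmerStructure
      (DiscreteGaloisModule.tateDual (K := K) (M := M) (ContinuousRep.toIntRep T) (p ^ n))),
    -- strict at the places above `p` (Rubin's `S_{Σ_p}`):
    (∀ w : HeightOneSpectrum (𝓞 K), ((p : ℕ) : 𝓞 K) ∈ w.asIdeal → 𝓛 (Sum.inr w) = ⊥) →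
    -- unramified at the usable (tame) primes:
    (∀ w ∈ L.primes, 𝓛 (Sum.inr w) ≤
      GaloisRep.unramifiedSubgroup
        (GaloisRep.toLocal w (DiscreteGaloisModule.tateDual (K := K) (M := M) (ContinuousRep.toIntRep T) (p ^ n)))
        1) →
    -- residual `H⁰`-vanishing (the visibly RESIDUAL part of Rubin's Hyp(K_∞, T)):
    (∀ m : M, (∀ σ : Field.absoluteGaloisGroup K, ∃ m' : M, T σ m - m = (p : ZMod (p ^ n)) • m') →
      ∃ m' : M, m = (p : ZMod (p ^ n)) • m') →
    ∃ C : ℕ, 𝓛.HasCardLE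
      ((Submodule.span (ZMod (p ^ n)) {hc.bottomClass}).toAddSubgroup.index * p ^ C)

end Summit.BirchSwinnertonDyer.BirchSwinnertonDyer.Cruxes.VerticalSelmerBound.Sketch
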